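import Summits.CriticalPhenomena.SAWScalingLimit.Theorems.SAWRenewalTightnessTubeLowerBoundCornerStaircase

/-!
# Crux `TubeLowerBound` (stmt-CriticalPhenomena-4730), line `bridge-doubling-tower`: stub S3, the diamond staircase

`stub_diamondStaircase : diamond-piece floor → FirstOctantTubeFloor`.  The hypothesis (conclusion of S2
`stub_doublingUpgrade`) is a pointwise polynomial floor `c s^{-C}` for the `x_c`-mass of DIAMOND PIECES of every
span `s ≥ 1`: self-avoiding walks `0 → (s, 0)` whose points at times `1 ≤ i < n` lie strictly inside the open
`ℓ¹`-diamond with diagonal `[0, (s,0)]` (`|y| < x`, `|y| < s − x`) and all of whose points satisfy `10|y| ≤ s`.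
For naturals `b ≤ a`, `ℓ₀ = max(1, |(a,b)|)`, tube-confined walks `0 → (a, b)` are glued along the corner
staircase `Q_j = (⌊j a/n⌋, ⌊j b/n⌋)`, `n = min(20, a)` (`CornerStaircase.nR/xc/yc`, `corner_facts`): round
`j + 1` is a horizontal diamond piece of span `x_{j+1} − x_j ≥ 1` from `Q_j`, then (if `y_{j+1} > y_j`) a
vertical one (coordinate swap, `tubeMass_swap_le`) of span `y_{j+1} − y_j`.  SELF-AVOIDANCE IS FREE: with
`φ = x + y`, the walk built up to a corner `P` lies in `{φ < φ(P)} ∪ {P}` while a piece started at `P` lies in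
`{P} ∪ {φ > φ(P)}` and inside `{φ < φ(P')} ∪ {P'}` for its far corner `P'`, so `CornerStaircase.tubeMass_concat`
applies `2n` times (`round_stepD`).  TUBE: a point of round `j + 1` is within `a/n + |offset| + 1 ≤ a/10 + 2` of
the segment in the coordinate test `infDist_segment_le_coord` (`alpha_diam`, `tube_of_DH`, `tube_of_DV`).  MASS:
every piece has span `≤ a ≤ ℓ₀`, hence mass `≥ γ = min(c,1) ℓ₀^{-C} ≤ 1`; `n ≤ 20` rounds give `≥ γ^{40}`:
`C' = 40 C`, `c' = min(c,1)^{40}`.  No definitions: the piece and region predicates are written inline.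
-/

noncomputable section

namespace Summit.CriticalPhenomena.SAWScalingLimit.Theorems.TubeLowerBound.BridgeDoublingTower

open scoped BigOperators Classical
open Literature.Probability.LatticeModels Literature.Probability.RandomPlanarGeometry
open Literature.Probability.RandomPlanarGeometry.SAW
open Literature.Probability.Percolation.Contour (site_ext)
open Summit.CriticalPhenomena.SAWScalingLimit.Theorems.TubeLowerBound.LiebSimonStar
open Summit.CriticalPhenomena.SAWScalingLimit.Theorems.TubeLowerBound.LiebSimonStar.CornerStaircase

namespace DiamondStaircase

/-! ### Tube geometry of the diamond pieces -/

/-- With `α = a/n`, `n = min(20, a)`, `a ≥ 1`: if `10 t ≤ s` for integers `t, s` with `s < α + 1` then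
`α + t ≤ a/10 + 1` (for `a ≤ 20`, `α = 1` and `s ≤ 1` force `t ≤ 0`; for `a ≥ 20`, `α = a/20`). -/
theorem alpha_diam {a : ℕ} (ha : 1 ≤ a) {t s : ℤ} (ht : 10 * t ≤ s)
    (hs : (s : ℝ) < (a : ℝ) / nR a + 1) : (a : ℝ) / nR a + t ≤ (a : ℝ) / 10 + 1 := by
  have ha' : (1 : ℝ) ≤ a := by exact_mod_cast ha
  have ht' : 10 * (t : ℝ) ≤ s := by exact_mod_cast ht
  unfold nR at hs ⊢
  rcases le_total a 20 with h20 | h20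
  · rw [min_eq_right h20, div_self (by positivity)] at hs ⊢
    have hs2 : s < 2 := by exact_mod_cast (show (s : ℝ) < 2 by linarith)
    have ht0' : (t : ℝ) ≤ 0 := by exact_mod_cast (show t ≤ 0 by omega)
    have : (0 : ℝ) ≤ (a : ℝ) / 10 := by positivity
    linarith
  · rw [min_eq_left h20] at hs ⊢
    have h20' : (20 : ℝ) ≤ a := by exact_mod_cast h20
    push_cast at hs ⊢
    linarith

/-- `y_{j+1} ≤ b` for every round `j + 1 ≤ n`. -/
theorem yc_succ_le {a b j : ℕ} (hj : j + 1 ≤ nR a) : yc a b (j + 1) ≤ b := by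
  have hn : 0 < nR a := by omega
  calc yc a b (j + 1) = (j + 1) * b / nR a := rfl
    _ ≤ nR a * b / nR a := Nat.div_le_div_right (Nat.mul_le_mul_right b hj)
    _ = b := Nat.mul_div_cancel_left b hn

/-- **Tube test, horizontal diamond piece.**  In round `j + 1`, a point with abscissa in `[x_j, x_{j+1}]` and
ordinate within `(x_{j+1} − x_j)/10` of `y_j` lies in the tube: compare with the point of parameter `j/n`. -/
theorem tube_of_DH {a b j : ℕ} (hj : j + 1 ≤ nR a) {p : Site 2}
    (h0 : ((xc a j : ℕ) : ℤ) ≤ p 0) (h0' : p 0 ≤ xc a (j + 1))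
    (h1 : 10 * (p 1 - yc a b j) ≤ (xc a (j + 1) : ℤ) - xc a j)
    (h1' : 10 * ((yc a b j : ℤ) - p 1) ≤ (xc a (j + 1) : ℤ) - xc a j) : p ∈ tubeSet a b := by
  have hn : 0 < nR a := by omega
  have ha : 1 ≤ a := le_trans (by omega : 1 ≤ nR a) (min_le_right 20 a)
  have hn' : (0 : ℝ) < nR a := by exact_mod_cast hn
  obtain ⟨hα1, -⟩ := alpha_facts ha
  obtain ⟨⟨-, hX'⟩, ⟨hY, hY'⟩⟩ := corner_real a b j hn
  obtain ⟨⟨hX1, -⟩, -⟩ := corner_real a b (j + 1) hn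
  have e1 : ((j + 1 : ℕ) : ℝ) / nR a * a = (j : ℝ) / nR a * a + a / nR a := by push_cast; ring
  rw [e1] at hX1
  have r0 : ((xc a j : ℕ) : ℝ) ≤ ((p 0 : ℤ) : ℝ) := by exact_mod_cast h0
  have r0' : ((p 0 : ℤ) : ℝ) ≤ ((xc a (j + 1) : ℕ) : ℝ) := by exact_mod_cast h0'
  -- the span `x_{j+1} - x_j < α + 1`
  have hs : ((((xc a (j + 1) : ℕ) : ℤ) - xc a j : ℤ) : ℝ) < (a : ℝ) / nR a + 1 := by
    push_cast; linarith
  have ht₁ := alpha_diam ha h1 hs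
  have ht₂ := alpha_diam ha h1' hs
  push_cast at ht₁ ht₂
  have hℓ := cast_le_ell0 a b
  have key := infDist_segment_le_coord a b p ((j : ℝ) / nR a) (by positivity)
    (by rw [div_le_one hn']; exact_mod_cast (by omega : j ≤ nR a))
  refine key.trans ?_
  have A : |((p 0 : ℤ) : ℝ) - (j : ℝ) / nR a * a| ≤ (a : ℝ) / nR a := by
    rw [abs_le]; constructor <;> linarith
  have B : |((p 1 : ℤ) : ℝ) - (j : ℝ) / nR a * b| ≤ (a : ℝ) / 10 + 2 - (a : ℝ) / nR a := by
    rw [abs_le]; constructor <;> linarith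
  linarith

/-- **Tube test, vertical diamond piece.**  In round `j + 1`, a point with ordinate in `[y_j, y_{j+1}]` and
abscissa within `(y_{j+1} − y_j)/10` of `x_{j+1}` lies in the tube: compare with the point of abscissa
`x_{j+1}` of the segment. -/
theorem tube_of_DV {a b j : ℕ} (hba : b ≤ a) (hj : j + 1 ≤ nR a) {p : Site 2}
    (h0 : 10 * (p 0 - xc a (j + 1)) ≤ (yc a b (j + 1) : ℤ) - yc a b j)
    (h0' : 10 * ((xc a (j + 1) : ℤ) - p 0) ≤ (yc a b (j + 1) : ℤ) - yc a b j)
    (h1 : ((yc a b j : ℕ) : ℤ) ≤ p 1) (h1' : p 1 ≤ yc a b (j + 1)) : p ∈ tubeSet a b := by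
  have hn : 0 < nR a := by omega
  have ha : 1 ≤ a := le_trans (by omega : 1 ≤ nR a) (min_le_right 20 a)
  have ha0 : (0 : ℝ) < a := by exact_mod_cast ha
  have hba' : (b : ℝ) ≤ a := by exact_mod_cast hba
  obtain ⟨hα1, -⟩ := alpha_facts ha
  obtain ⟨-, ⟨-, hY'⟩⟩ := corner_real a b j hn
  obtain ⟨⟨hX1, hX1'⟩, ⟨hY1, -⟩⟩ := corner_real a b (j + 1) hn
  have e1 : ((j + 1 : ℕ) : ℝ) / nR a * a = (j : ℝ) / nR a * a + a / nR a := by push_cast; ring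
  have e2 : ((j + 1 : ℕ) : ℝ) / nR a * b = (j : ℝ) / nR a * b + b / nR a := by push_cast; ring
  rw [e1] at hX1 hX1'; rw [e2] at hY1
  have hβα : (b : ℝ) / nR a ≤ a / nR a := div_le_div_of_nonneg_right hba' (Nat.cast_nonneg _)
  have hxa : ((xc a (j + 1) : ℕ) : ℝ) ≤ a := by exact_mod_cast (corner_facts hba hj).2.2.2.2.2.2
  have r1 : ((yc a b j : ℕ) : ℝ) ≤ ((p 1 : ℤ) : ℝ) := by exact_mod_cast h1
  have r1' : ((p 1 : ℤ) : ℝ) ≤ ((yc a b (j + 1) : ℕ) : ℝ) := by exact_mod_cast h1'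
  -- the span `y_{j+1} - y_j < β + 1 ≤ α + 1`
  have hs : ((((yc a b (j + 1) : ℕ) : ℤ) - yc a b j : ℤ) : ℝ) < (a : ℝ) / nR a + 1 := by
    push_cast; linarith
  have ht₁ := alpha_diam ha h0 hs
  have ht₂ := alpha_diam ha h0' hs
  push_cast at ht₁ ht₂
  have hℓ := cast_le_ell0 a b
  -- the comparison point `(x_{j+1}, W)`, `W = x_{j+1} b / a`
  have key := infDist_segment_le_coord a b p (((xc a (j + 1) : ℕ) : ℝ) / a) (by positivity)
    (by rwa [div_le_one ha0])
  have es : ((xc a (j + 1) : ℕ) : ℝ) / a * a = ((xc a (j + 1) : ℕ) : ℝ) := by field_simp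
  rw [es] at key
  have hW1 : ((xc a (j + 1) : ℕ) : ℝ) / a * b ≤ (j : ℝ) / nR a * b + b / nR a := by
    calc ((xc a (j + 1) : ℕ) : ℝ) / a * b = ((xc a (j + 1) : ℕ) : ℝ) * (b / a) := by ring
      _ ≤ ((j : ℝ) / nR a * a + a / nR a) * (b / a) := mul_le_mul_of_nonneg_right hX1 (by positivity)
      _ = (j : ℝ) / nR a * b + b / nR a := by field_simp
  have hW2 : (j : ℝ) / nR a * b + b / nR a - 1 ≤ ((xc a (j + 1) : ℕ) : ℝ) / a * b := by
    have hba1 : (b : ℝ) / a ≤ 1 := by rwa [div_le_one ha0]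
    calc (j : ℝ) / nR a * b + b / nR a - 1 ≤ (j : ℝ) / nR a * b + b / nR a - b / a := by linarith
      _ = ((j : ℝ) / nR a * a + a / nR a - 1) * (b / a) := by field_simp
      _ ≤ ((xc a (j + 1) : ℕ) : ℝ) * (b / a) := mul_le_mul_of_nonneg_right hX1'.le (by positivity)
      _ = ((xc a (j + 1) : ℕ) : ℝ) / a * b := by ring
  refine key.trans ?_
  have A : |((p 0 : ℤ) : ℝ) - ((xc a (j + 1) : ℕ) : ℝ)| ≤ (a : ℝ) / 10 + 1 - (a : ℝ) / nR a := by
    rw [abs_le]; constructor <;> linarith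
  have B : |((p 1 : ℤ) : ℝ) - ((xc a (j + 1) : ℕ) : ℝ) / a * b| ≤ 1 + (a : ℝ) / nR a := by
    rw [abs_le]; constructor <;> linarith
  linarith

/-! ### The pieces and the rounds -/

section Pieces

variable {C c : ℝ}
  (h : ∀ s : ℕ, 1 ≤ s → ∃ N : ℕ, c * (s : ℝ) ^ (-C) ≤ ∑ n ∈ Finset.range (N + 1),
    ∑ _ω ∈ (Zd.saws 2 n).filter (fun ω => ω n 0 = (s : ℤ) ∧ ω n 1 = 0 ∧
        (∀ i, 1 ≤ i → i < n → |ω i 1| < ω i 0 ∧ |ω i 1| < (s : ℤ) - ω i 0) ∧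
        (∀ i ≤ n, 10 * |ω i 1| ≤ (s : ℤ))), criticalFugacity ^ n)

include h in
/-- **The horizontal diamond piece**, uniformly in the span `s ≥ 0`: the hypothesis family at span `s ≥ 1` is
contained in the two-point family `0 → (s, 0)` confined by the SITE predicate “strictly inside the diamond
(`-x < y < x`, `x ± y < s`) or one of its corners `0`, `(s, 0)`; and `10|y| ≤ s`” (a self-avoiding walk visits
`0` only at time `0` and `(s, 0)` only at time `n`), so the latter has `x_c`-mass `≥ min(c, 1) max(1, s)^{-C}`;
for `s = 0` this is the trivial walk. -/
theorem pieceH_floor (s : ℕ) : ∃ N : ℕ, min c 1 * (max 1 (s : ℝ)) ^ (-C) ≤ ∑ n ∈ Finset.range (N + 1),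
    ∑ _ω ∈ (Zd.sawFun 2 n ![(s : ℤ), 0]).filter (fun ω => ∀ i ≤ n,
      ((-ω i 0 < ω i 1 ∧ ω i 1 < ω i 0 ∧ ω i 0 + ω i 1 < (s : ℤ) ∧ ω i 0 - ω i 1 < (s : ℤ)) ∨
        (ω i 1 = 0 ∧ (ω i 0 = 0 ∨ ω i 0 = (s : ℤ)))) ∧ -(s : ℤ) ≤ 10 * ω i 1 ∧ 10 * ω i 1 ≤ (s : ℤ)),
      criticalFugacity ^ n := by
  rcases Nat.eq_zero_or_pos s with rfl | hs
  · refine ⟨0, ?_⟩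
    calc min c 1 * (max 1 ((0 : ℕ) : ℝ)) ^ (-C) = min c 1 := by simp
      _ ≤ 1 := min_le_right _ _
      _ ≤ _ := one_le_tubeMass_zero (P := fun q : Site 2 =>
          ((-q 0 < q 1 ∧ q 1 < q 0 ∧ q 0 + q 1 < ((0 : ℕ) : ℤ) ∧ q 0 - q 1 < ((0 : ℕ) : ℤ)) ∨
            (q 1 = 0 ∧ (q 0 = 0 ∨ q 0 = ((0 : ℕ) : ℤ)))) ∧
            -((0 : ℕ) : ℤ) ≤ 10 * q 1 ∧ 10 * q 1 ≤ ((0 : ℕ) : ℤ))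
          (by simp) (site_ext (by simp) (by simp)) 0
  · obtain ⟨N, hN⟩ := h s hs
    refine ⟨N, le_trans ?_ (hN.trans ?_)⟩
    · rw [max_eq_right (by exact_mod_cast hs)]
      exact mul_le_mul_of_nonneg_right (min_le_left _ _) (Real.rpow_nonneg (Nat.cast_nonneg s) _)
    · refine Finset.sum_le_sum fun n _ => Finset.sum_le_sum_of_subset_of_nonneg (fun ω hω => ?_)
        fun _ _ _ => pow_nonneg criticalFugacity_pos.le n
      rw [Finset.mem_filter] at hω ⊢
      obtain ⟨hωs, he0, he1, hint, htube⟩ := hω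
      have h0 : ω 0 = 0 := (Zd.mem_saws.1 hωs).1
      refine ⟨Zd.mem_sawFun_iff_mem_saws.2 ⟨hωs, site_ext (by simpa using he0) (by simpa using he1)⟩,
        fun i hi => ⟨?_, ?_⟩⟩
      · rcases Nat.eq_zero_or_pos i with rfl | hi1
        · exact Or.inr (by simp [h0])
        · rcases lt_or_ge i n with hin | hin
          · have h2 := hint i hi1 hin
            rw [abs_lt, abs_lt] at h2
            exact Or.inl (by omega)
          · obtain rfl : i = n := le_antisymm hi hin
            exact Or.inr ⟨he1, Or.inr he0⟩
      · have h3 := htube i hi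
        have h4 := le_abs_self (ω i 1)
        have h5 := neg_abs_le (ω i 1)
        omega

include h in
/-- **The vertical diamond piece**: the coordinate swap of the horizontal one — walks `0 → (0, s)` confined by
the swapped site predicate, of `x_c`-mass `≥ min(c, 1) max(1, s)^{-C}`. -/
theorem pieceV_floor (s : ℕ) : ∃ N : ℕ, min c 1 * (max 1 (s : ℝ)) ^ (-C) ≤ ∑ n ∈ Finset.range (N + 1),
    ∑ _ω ∈ (Zd.sawFun 2 n ![0, (s : ℤ)]).filter (fun ω => ∀ i ≤ n,
      ((-ω i 1 < ω i 0 ∧ ω i 0 < ω i 1 ∧ ω i 1 + ω i 0 < (s : ℤ) ∧ ω i 1 - ω i 0 < (s : ℤ)) ∨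
        (ω i 0 = 0 ∧ (ω i 1 = 0 ∨ ω i 1 = (s : ℤ)))) ∧ -(s : ℤ) ≤ 10 * ω i 0 ∧ 10 * ω i 0 ≤ (s : ℤ)),
      criticalFugacity ^ n := by
  obtain ⟨N, hN⟩ := pieceH_floor h s
  exact ⟨N, hN.trans (tubeMass_swap_le
    (P := fun q : Site 2 =>
      ((-q 0 < q 1 ∧ q 1 < q 0 ∧ q 0 + q 1 < (s : ℤ) ∧ q 0 - q 1 < (s : ℤ)) ∨
        (q 1 = 0 ∧ (q 0 = 0 ∨ q 0 = (s : ℤ)))) ∧ -(s : ℤ) ≤ 10 * q 1 ∧ 10 * q 1 ≤ (s : ℤ))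
    (P' := fun q : Site 2 =>
      ((-q 1 < q 0 ∧ q 0 < q 1 ∧ q 1 + q 0 < (s : ℤ) ∧ q 1 - q 0 < (s : ℤ)) ∨
        (q 0 = 0 ∧ (q 1 = 0 ∨ q 1 = (s : ℤ)))) ∧ -(s : ℤ) ≤ 10 * q 0 ∧ 10 * q 0 ≤ (s : ℤ))
    (fun p hp => by simpa using hp) N (by simp) (by simp))⟩

include h in
/-- **One round.**  A floor `B` for the staircase walks to `Q_j` (confined to `({φ < φ(Q_j)} ∪ {Q_j}) ∩ tube`,
`φ = x + y`) gives the floor `B γ²`, `γ = min(c, 1) ℓ₀^{-C}`, at `Q_{j+1}`: glue the horizontal diamond piece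
of span `x_{j+1} − x_j` (to `P = (x_{j+1}, y_j)`, region `({φ < φ(P)} ∪ {P}) ∩ tube`) and, if `y_{j+1} > y_j`,
the vertical diamond piece of span `y_{j+1} − y_j` by `tubeMass_concat`, the separation being read off `φ`;
each piece has mass `≥ γ ≤ 1`. -/
theorem round_stepD (hC : 0 ≤ C) (hc : 0 < c) {a b j : ℕ} (hba : b ≤ a) (hj : j + 1 ≤ nR a) {B : ℝ}
    (hB : 0 ≤ B) {N : ℕ} (hN : B ≤ ∑ n ∈ Finset.range (N + 1),
      ∑ _ω ∈ (Zd.sawFun 2 n ![((xc a j : ℕ) : ℤ), ((yc a b j : ℕ) : ℤ)]).filter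
        (fun ω => ∀ i ≤ n, (ω i 0 + ω i 1 < ((xc a j : ℕ) : ℤ) + ((yc a b j : ℕ) : ℤ) ∨
            (ω i 0 = ((xc a j : ℕ) : ℤ) ∧ ω i 1 = ((yc a b j : ℕ) : ℤ))) ∧ ω i ∈ tubeSet a b),
        criticalFugacity ^ n) :
    ∃ N' : ℕ, B * (min c 1 *
        (max 1 (dist (Site.toComplex (0 : Site 2)) (Site.toComplex (![(a : ℤ), (b : ℤ)] : Site 2)))) ^ (-C)) ^ 2 ≤
      ∑ n ∈ Finset.range (N' + 1),
        ∑ _ω ∈ (Zd.sawFun 2 n ![((xc a (j + 1) : ℕ) : ℤ), ((yc a b (j + 1) : ℕ) : ℤ)]).filter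
          (fun ω => ∀ i ≤ n, (ω i 0 + ω i 1 < ((xc a (j + 1) : ℕ) : ℤ) + ((yc a b (j + 1) : ℕ) : ℤ) ∨
              (ω i 0 = ((xc a (j + 1) : ℕ) : ℤ) ∧ ω i 1 = ((yc a b (j + 1) : ℕ) : ℤ))) ∧ ω i ∈ tubeSet a b),
          criticalFugacity ^ n := by
  obtain ⟨hq1, -, hx1, -, hy1, -, hxa⟩ := corner_facts hba hj
  have hyb := yc_succ_le (b := b) hj
  have hℓ1 : (1 : ℝ) ≤ max 1 (dist (Site.toComplex (0 : Site 2))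
      (Site.toComplex (![(a : ℤ), (b : ℤ)] : Site 2))) := le_max_left _ _
  have haℓ := cast_le_ell0 a b
  set γ := min c 1 *
    (max 1 (dist (Site.toComplex (0 : Site 2)) (Site.toComplex (![(a : ℤ), (b : ℤ)] : Site 2)))) ^ (-C) with hγ
  have hc1 : 0 ≤ min c 1 := le_min hc.le zero_le_one
  have hγ0 : 0 ≤ γ := mul_nonneg hc1 (Real.rpow_nonneg (by positivity) _)
  have hγ1 : γ ≤ 1 := (mul_le_of_le_one_right hc1
    (Real.rpow_le_one_of_one_le_of_nonpos hℓ1 (by linarith))).trans (min_le_right _ _)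
  -- every piece of span `L ≤ a` has mass `≥ γ`
  have hblock : ∀ L : ℕ, L ≤ a → γ ≤ min c 1 * (max 1 (L : ℝ)) ^ (-C) := by
    intro L hL
    refine mul_le_mul_of_nonneg_left ?_ hc1
    refine Real.rpow_le_rpow_of_nonpos (by positivity) (max_le hℓ1 ?_) (by linarith)
    exact le_trans (by exact_mod_cast hL) haℓ
  -- the horizontal diamond piece of round `j + 1`, span `s = x_{j+1} - x_j ≥ 1`
  obtain ⟨s, hs⟩ : ∃ s : ℕ, xc a (j + 1) = xc a j + s := ⟨xc a (j + 1) - xc a j, by omega⟩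
  obtain ⟨N₂, hN₂⟩ := pieceH_floor h s
  have hA := tubeMass_concat
    (P := fun p : Site 2 => (p 0 + p 1 < ((xc a j : ℕ) : ℤ) + ((yc a b j : ℕ) : ℤ) ∨
        (p 0 = ((xc a j : ℕ) : ℤ) ∧ p 1 = ((yc a b j : ℕ) : ℤ))) ∧ p ∈ tubeSet a b)
    (Q := fun q : Site 2 =>
      ((-q 0 < q 1 ∧ q 1 < q 0 ∧ q 0 + q 1 < (s : ℤ) ∧ q 0 - q 1 < (s : ℤ)) ∨
        (q 1 = 0 ∧ (q 0 = 0 ∨ q 0 = (s : ℤ)))) ∧ -(s : ℤ) ≤ 10 * q 1 ∧ 10 * q 1 ≤ (s : ℤ))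
    (R := fun p : Site 2 => (p 0 + p 1 < ((xc a (j + 1) : ℕ) : ℤ) + ((yc a b j : ℕ) : ℤ) ∨
        (p 0 = ((xc a (j + 1) : ℕ) : ℤ) ∧ p 1 = ((yc a b j : ℕ) : ℤ))) ∧ p ∈ tubeSet a b)
    (e₁ := ![((xc a j : ℕ) : ℤ), ((yc a b j : ℕ) : ℤ)]) (e₂ := ![(s : ℤ), 0])
    (e := ![((xc a (j + 1) : ℕ) : ℤ), ((yc a b j : ℕ) : ℤ)])
    (site_ext (by simp only [Pi.add_apply, Matrix.cons_val_zero]; omega) (by simp)) ?hPA ?hQA ?hsA N N₂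
  case hPA =>
    rintro p ⟨hp, hpT⟩
    exact ⟨by omega, hpT⟩
  case hQA =>
    rintro q ⟨hq, hq10, hq10'⟩
    have c0 : (![((xc a j : ℕ) : ℤ), ((yc a b j : ℕ) : ℤ)] + q) 0 = xc a j + q 0 := by simp
    have c1 : (![((xc a j : ℕ) : ℤ), ((yc a b j : ℕ) : ℤ)] + q) 1 = yc a b j + q 1 := by simp
    refine ⟨?_, tube_of_DH hj (by rw [c0]; omega) (by rw [c0]; omega) (by rw [c1]; omega)
      (by rw [c1]; omega)⟩
    rw [c0, c1]
    omega
  case hsA =>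
    rintro p q ⟨hp, -⟩ ⟨hq, -⟩ h0 h1
    simp only [Matrix.cons_val_zero, Matrix.cons_val_one] at h0 h1
    omega
  have hA' := le_trans (mul_le_mul hN ((hblock _ (by omega)).trans hN₂) hγ0 (hB.trans hN)) hA
  rcases Nat.eq_or_lt_of_le hy1 with hy | hy
  · -- no vertical piece: `y_{j+1} = y_j`
    refine ⟨N + N₂, ?_⟩
    rw [← hy]
    calc B * γ ^ 2 ≤ B * γ := mul_le_mul_of_nonneg_left (pow_le_of_le_one hγ0 hγ1 two_ne_zero) hB
      _ ≤ _ := hA'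
  · -- the vertical diamond piece of round `j + 1`, span `t = y_{j+1} - y_j ≥ 1`
    obtain ⟨t, ht⟩ : ∃ t : ℕ, yc a b (j + 1) = yc a b j + t := ⟨yc a b (j + 1) - yc a b j, by omega⟩
    obtain ⟨N₃, hN₃⟩ := pieceV_floor h t
    have hV := tubeMass_concat
      (P := fun p : Site 2 => (p 0 + p 1 < ((xc a (j + 1) : ℕ) : ℤ) + ((yc a b j : ℕ) : ℤ) ∨
          (p 0 = ((xc a (j + 1) : ℕ) : ℤ) ∧ p 1 = ((yc a b j : ℕ) : ℤ))) ∧ p ∈ tubeSet a b)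
      (Q := fun q : Site 2 =>
        ((-q 1 < q 0 ∧ q 0 < q 1 ∧ q 1 + q 0 < (t : ℤ) ∧ q 1 - q 0 < (t : ℤ)) ∨
          (q 0 = 0 ∧ (q 1 = 0 ∨ q 1 = (t : ℤ)))) ∧ -(t : ℤ) ≤ 10 * q 0 ∧ 10 * q 0 ≤ (t : ℤ))
      (R := fun p : Site 2 => (p 0 + p 1 < ((xc a (j + 1) : ℕ) : ℤ) + ((yc a b (j + 1) : ℕ) : ℤ) ∨
          (p 0 = ((xc a (j + 1) : ℕ) : ℤ) ∧ p 1 = ((yc a b (j + 1) : ℕ) : ℤ))) ∧ p ∈ tubeSet a b)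
      (e₁ := ![((xc a (j + 1) : ℕ) : ℤ), ((yc a b j : ℕ) : ℤ)]) (e₂ := ![0, (t : ℤ)])
      (e := ![((xc a (j + 1) : ℕ) : ℤ), ((yc a b (j + 1) : ℕ) : ℤ)])
      (site_ext (by simp) (by simp only [Pi.add_apply, Matrix.cons_val_one, Matrix.cons_val_zero]; omega))
      ?hPV ?hQV ?hsV (N + N₂) N₃
    case hPV =>
      rintro p ⟨hp, hpT⟩
      exact ⟨by omega, hpT⟩
    case hQV =>
      rintro q ⟨hq, hq10, hq10'⟩
      have c0 : (![((xc a (j + 1) : ℕ) : ℤ), ((yc a b j : ℕ) : ℤ)] + q) 0 = xc a (j + 1) + q 0 := by simp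
      have c1 : (![((xc a (j + 1) : ℕ) : ℤ), ((yc a b j : ℕ) : ℤ)] + q) 1 = yc a b j + q 1 := by simp
      refine ⟨?_, tube_of_DV hba hj (by rw [c0]; omega) (by rw [c0]; omega) (by rw [c1]; omega)
        (by rw [c1]; omega)⟩
      rw [c0, c1]
      omega
    case hsV =>
      rintro p q ⟨hp, -⟩ ⟨hq, -⟩ h0 h1
      simp only [Matrix.cons_val_zero, Matrix.cons_val_one] at h0 h1
      omega
    refine ⟨N + N₂ + N₃, ?_⟩
    calc B * γ ^ 2 = (B * γ) * γ := by ring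
      _ ≤ _ := mul_le_mul hA' ((hblock _ (by omega)).trans hN₃) hγ0 (le_trans (by positivity) hA')
      _ ≤ _ := hV

end Pieces

end DiamondStaircase

/-! ### The stub -/

open DiamondStaircase in
/-- **Stub S3 of the line `bridge-doubling-tower`: the diamond staircase.**  If diamond pieces of every span
`s ≥ 1` (self-avoiding walks `0 → (s, 0)` with interior points in `|y| < min(x, s − x)` and all points in
`10|y| ≤ s`) have `x_c`-mass `≥ c s^{-C}`, then `FirstOctantTubeFloor` holds with `C' = 40 C`,
`c' = min(c, 1)^{40}`: for naturals `b ≤ a`, `ℓ₀ = max(1, |(a,b)|)`, horizontal and vertical diamond pieces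
glued through the corners `(⌊j a/n⌋, ⌊j b/n⌋)`, `n = min(20, a)`, are tube-confined self-avoiding walks
`0 → (a, b)` (self-avoidance from the `φ = x + y` slabs) of `x_c`-mass
`≥ (min(c,1) ℓ₀^{-C})^{2n} ≥ min(c,1)^{40} ℓ₀^{-40 C}`. -/
theorem stub_diamondStaircase :
    (∃ C c : ℝ, 0 ≤ C ∧ 0 < c ∧ ∀ s : ℕ, 1 ≤ s → ∃ N : ℕ,
      c * (s : ℝ) ^ (-C) ≤
        ∑ n ∈ Finset.range (N + 1),
          ∑ _ω ∈ (SAW.Zd.saws 2 n).filter (fun ω =>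
              ω n 0 = (s : ℤ) ∧ ω n 1 = 0 ∧
              (∀ i, 1 ≤ i → i < n → |ω i 1| < ω i 0 ∧ |ω i 1| < (s : ℤ) - ω i 0) ∧
              (∀ i ≤ n, 10 * |ω i 1| ≤ (s : ℤ))),
            SAW.criticalFugacity ^ n) →
    FirstOctantTubeFloor := by
  rintro ⟨C, c, hC, hc, h⟩
  refine ⟨40 * C, (min c 1) ^ 40, by positivity, pow_pos (lt_min hc one_pos) 40, fun a b hba => ?_⟩
  set ℓ₀ := max 1 (dist (Site.toComplex (0 : Site 2)) (Site.toComplex (![(a : ℤ), (b : ℤ)] : Site 2)))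
  have hℓ1 : 1 ≤ ℓ₀ := le_max_left _ _
  have hc1 : 0 ≤ min c 1 := le_min hc.le zero_le_one
  set γ := min c 1 * ℓ₀ ^ (-C)
  have hγ0 : 0 ≤ γ := mul_nonneg hc1 (Real.rpow_nonneg (by positivity) _)
  have hγ1 : γ ≤ 1 := (mul_le_of_le_one_right hc1
    (Real.rpow_le_one_of_one_le_of_nonpos hℓ1 (by linarith))).trans (min_le_right _ _)
  -- induction over the rounds
  have claim : ∀ j, j ≤ nR a → ∃ N : ℕ, (γ ^ 2) ^ j ≤ ∑ n ∈ Finset.range (N + 1),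
      ∑ _ω ∈ (Zd.sawFun 2 n ![((xc a j : ℕ) : ℤ), ((yc a b j : ℕ) : ℤ)]).filter
        (fun ω => ∀ i ≤ n, (ω i 0 + ω i 1 < ((xc a j : ℕ) : ℤ) + ((yc a b j : ℕ) : ℤ) ∨
            (ω i 0 = ((xc a j : ℕ) : ℤ) ∧ ω i 1 = ((yc a b j : ℕ) : ℤ))) ∧ ω i ∈ tubeSet a b),
        criticalFugacity ^ n := by
    intro j
    induction j with
    | zero =>
      intro _
      refine ⟨0, ?_⟩
      rw [pow_zero]
      refine one_le_tubeMass_zero (P := fun p : Site 2 =>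
          (p 0 + p 1 < ((xc a 0 : ℕ) : ℤ) + ((yc a b 0 : ℕ) : ℤ) ∨
            (p 0 = ((xc a 0 : ℕ) : ℤ) ∧ p 1 = ((yc a b 0 : ℕ) : ℤ))) ∧ p ∈ tubeSet a b)
        ⟨?_, zero_mem_tubeSet a b⟩ (site_ext (by simp [xc]) (by simp [yc])) 0
      simp [xc, yc]
    | succ j ih =>
      intro hj
      obtain ⟨N, hN⟩ := ih (by omega)
      obtain ⟨N', hN'⟩ := round_stepD h hC hc hba hj (by positivity) hN
      exact ⟨N', by rw [pow_succ]; exact hN'⟩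
  obtain ⟨N, hN⟩ := claim (nR a) le_rfl
  rw [(xc_yc_nR hba).1, (xc_yc_nR hba).2] at hN
  refine ⟨N, le_trans ?_ (hN.trans ?_)⟩
  · have hℓ0 : 0 < ℓ₀ := by positivity
    have e : ℓ₀ ^ (-(40 * C)) = (ℓ₀ ^ (-C)) ^ (40 : ℕ) := by
      rw [← Real.rpow_natCast, ← Real.rpow_mul hℓ0.le]
      congr 1; push_cast; ring
    calc (min c 1) ^ 40 * ℓ₀ ^ (-(40 * C)) = (γ ^ 2) ^ 20 := by
          rw [e, ← mul_pow, ← pow_mul]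
      _ ≤ (γ ^ 2) ^ nR a := pow_le_pow_of_le_one (by positivity) (pow_le_one₀ hγ0 hγ1) (min_le_left 20 a)
  · exact tubeMass_mono (P := fun p : Site 2 => (p 0 + p 1 < ((a : ℕ) : ℤ) + ((b : ℕ) : ℤ) ∨
        (p 0 = ((a : ℕ) : ℤ) ∧ p 1 = ((b : ℕ) : ℤ))) ∧ p ∈ tubeSet a b)
      (R := fun p : Site 2 => Metric.infDist (Site.toComplex p)
          (segment ℝ (Site.toComplex (0 : Site 2)) (Site.toComplex (![(a : ℤ), (b : ℤ)] : Site 2))) ≤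
        max 1 (dist (Site.toComplex (0 : Site 2)) (Site.toComplex (![(a : ℤ), (b : ℤ)] : Site 2))) / 10 + 2)
      (fun p hp => hp.2) N _

end Summit.CriticalPhenomena.SAWScalingLimit.Theorems.TubeLowerBound.BridgeDoublingTower

end
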